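import Summits.CriticalPhenomena.PercolationContinuityZ3.Theorems.Transplant.PlanarSkeletonFrmScaledCoarseCyl
import Summits.CriticalPhenomena.PercolationContinuityZ3.Theorems.Transplant.PlanarSkeletonFrmScaledCoarseSubcrit
import Summits.CriticalPhenomena.PercolationContinuityZ3.Theorems.Transplant.PlanarSkeletonFrmScaledCoarseProxy
import Summits.CriticalPhenomena.PercolationContinuityZ3.Theorems.Transplant.PlanarSkeletonFrmFromDefs
import Summits.CriticalPhenomena.PercolationContinuityZ3.Theorems.Transplant.SkelPhiFatRadius
import HarnessLib

/-!
# The coarse-chart dictionary, PART 5 (U_s execution Us-1/Us-2 packaging, RULING D-Us, lead g21 V147b): **THE COARSE SKELETON AS A MULTI-TYPE `PlanarSkeletonFrmFrom`** —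
# `PlanarSkeletonFrmScaled.coarseFrmFrom Φ h1 hLN : PlanarSkeletonFrmFrom G` (chart `⌊φ/N⌋`, the `≤ N²` residue types, exact coarse frames, unit steps, degree bound, cylinders
# connected from `max ℓ₀ 1`), its Φ2 transfer, its BASE-TYPE PROXIES in carrier language, and the seed fact `c ∈ fatSeq c′ k` for `k ≥ D`

builds on p205010 (kernel theorem, internal audit signed; external expert review pending) — nothing in this file uses p205010.  ONE definition (`coarseFrmFrom`, a structure-valued
packaging of LANDED dictionary entries, parts 1–4: p430694 / p431613 / p432994 / p442392; review-queued by D-0009); no statement, no `@[conjecture]`; NOTHING about the OPEN nodes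
U (`SamePDropOfSkeletonFrmFrom₁`) / U_s (`SamePDropOfSkeletonFrmScaled₁`) is claimed.  Lane `prim-bschramm`, seat `prim-bschramm-p3` gen 26 (design owner); helper file
(`--supports stmt-CriticalPhenomena-4575 --as helper`).

WHY (V147b 'EXECUTION': 'the carrier wave is done ONCE on `PlanarSkeletonFrmFrom`, which the COARSE skeleton (G, ψ = ⌊φ/N⌋, residue types T, exact ψ-frames, unit steps,
CylConnFrom max ℓ₀ 1, CylSubcritical — dictionary parts 1–4) INSTANTIATES as a MULTI-TYPE `PlanarSkeletonFrmFrom`; so U's ported columns apply to it directly and only the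
single-type layer changes'): this file IS that instantiation.
* §1 **`coarseFrmFrom`** + field lemmas (`coarseFrmFrom_φ/_types_mem/_ℓ₀/_Δ`), `coarseTypes` (the chosen residue types, `t ∈ coarseTypes`, `card ≤ N²`, homogeneity);
* §2 **`coarseFrmFrom_cylSubcritical`** (Φ2 for the fine skeleton at `p` ⇒ Φ2 for `coarseFrmFrom` at `p`; part 3);
* §3 **`exists_proxies_frmFrom`** — part 4's proxies in carrier language: ONE `D` such that every `c` has `c′` with a `coarseFrmFrom`-frame `α : t ↦ c′`
  (`α t = c′`, `(coarseFrmFrom).φ ∘ α = (coarseFrmFrom).φ + ((coarseFrmFrom).φ c′ − (coarseFrmFrom).φ t)`), same coarse position, `c ∈ graphBall G c′ D`;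
* §4 `Skelφ.mem_fatSeq_of_mem_graphBall` (a vertex within graph distance `D ≤ k` of `c′` lies in the LEVEL-0 seed `fatSeq c′ k` — the (p4) of §19.12 in the form the kit junction
  reads: 'the current cluster ∋ c' ⇒ 'the current cluster meets `Λ c′`').
[cite: KozmaNitzan2024, §4 p. 15 (boxes and their translates), p. 16 (Lemma 8), pp. 19–21 ((21)–(25))] [cite: MartineauSevero2019, Cor. 2.2] [cite: BenjaminiSchramm1996, Conj. 4]
[this work]
-/

noncomputable section

namespace Summit.CriticalPhenomena.PercolationContinuityZ3.Theorems.Transplant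

open Literature.Probability.LatticeModels Literature.Probability.Percolation SimpleGraph
open Literature.Barriers.CriticalPhenomena (graphBall)
open scoped Classical

namespace PlanarSkeletonFrmScaled

variable {V : Type} {G : SimpleGraph V} [G.LocallyFinite] (Φ : PlanarSkeletonFrmScaled G)

/-! ## §1 The coarse skeleton as a multi-type frames-only skeleton with cylinders connected from `max ℓ₀ 1` -/

/-- **The chosen coarse types** of a one-type scaled skeleton (the finite set of residue representatives of part 1's `exists_coarseTypes`). [this work] -/
def coarseTypes {t : V} (h1 : Φ.types = {t}) : Finset V := (Φ.exists_coarseTypes h1).choose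

/-- The base vertex is a coarse type. [folklore] -/
theorem mem_coarseTypes {t : V} (h1 : Φ.types = {t}) : t ∈ Φ.coarseTypes h1 := (Φ.exists_coarseTypes h1).choose_spec.1

/-- There are at most `N²` coarse types. [folklore] -/
theorem card_coarseTypes_le {t : V} (h1 : Φ.types = {t}) : (Φ.coarseTypes h1).card ≤ Φ.N ^ 2 := (Φ.exists_coarseTypes h1).choose_spec.2.1

/-- The coarse chart has translating frames over the coarse types. [cite: KozmaNitzan2024, §4 p. 16 (Lemma 8)] -/
theorem frames_coarseTypes {t : V} (h1 : Φ.types = {t}) : Skelφ.Frames G Φ.coarse (Φ.coarseTypes h1) := (Φ.exists_coarseTypes h1).choose_spec.2.2.1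

/-- The coarse types are homogeneous: exchanged by automorphisms translating the FINE chart. [cite: KozmaNitzan2024, §4 p. 15] -/
theorem homogeneous_coarseTypes {t : V} (h1 : Φ.types = {t}) :
    ∀ t₁ ∈ Φ.coarseTypes h1, ∀ t₂ ∈ Φ.coarseTypes h1, ∃ β : G ≃g G, β t₁ = t₂ ∧ ∀ w, Φ.φ (β w) = Φ.φ w + (Φ.φ t₂ - Φ.φ t₁) :=
  (Φ.exists_coarseTypes h1).choose_spec.2.2.2

/-- **THE COARSE SKELETON AS A `PlanarSkeletonFrmFrom`** (`L ≤ N`): chart `⌊φ/N⌋` (1-Lipschitz, part 1), the `≤ N²` residue types with exact coarse frames (part 1), the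
degree bound of `Φ`, UNIT steps from the exact `N`-steps (p4-g16's `steps_coarse`), and cylinders connected from `max ℓ₀ 1` on (part 2). [cite: KozmaNitzan2024, §4 p. 16 (Lemma 8)] -/
def coarseFrmFrom {t : V} (h1 : Φ.types = {t}) (hLN : Φ.L ≤ Φ.N) : PlanarSkeletonFrmFrom G where
  φ := Φ.coarse
  lip := Φ.coarse_lip hLN
  types := Φ.coarseTypes h1
  frame := Φ.frames_coarseTypes h1
  Δ := Φ.Δ
  degree_le := Φ.degree_le
  step := Φ.steps_coarse
  ℓ₀ := max Φ.ℓ₀ 1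
  cyl_connected := Φ.coarse_cylConnFrom h1 (Φ.coarseTypes h1)

/-- The chart of the coarse skeleton is `⌊φ/N⌋`. [folklore] -/
@[simp] theorem coarseFrmFrom_φ {t : V} (h1 : Φ.types = {t}) (hLN : Φ.L ≤ Φ.N) : (Φ.coarseFrmFrom h1 hLN).φ = Φ.coarse := rfl

/-- The types of the coarse skeleton are the chosen coarse types. [folklore] -/
@[simp] theorem coarseFrmFrom_types {t : V} (h1 : Φ.types = {t}) (hLN : Φ.L ≤ Φ.N) : (Φ.coarseFrmFrom h1 hLN).types = Φ.coarseTypes h1 := rfl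

/-- The width of the coarse skeleton is `max ℓ₀ 1`. [folklore] -/
@[simp] theorem coarseFrmFrom_ℓ₀ {t : V} (h1 : Φ.types = {t}) (hLN : Φ.L ≤ Φ.N) : (Φ.coarseFrmFrom h1 hLN).ℓ₀ = max Φ.ℓ₀ 1 := rfl

/-- The base vertex is a type of the coarse skeleton. [folklore] -/
theorem mem_coarseFrmFrom_types {t : V} (h1 : Φ.types = {t}) (hLN : Φ.L ≤ Φ.N) : t ∈ (Φ.coarseFrmFrom h1 hLN).types := Φ.mem_coarseTypes h1

/-! ## §2 Φ2 transfers to the coarse skeleton -/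

/-- **Φ2 for the coarse skeleton**: subcritical fine cylinders at `p` give subcritical coarse cylinders at `p` (part 3's `coarse_cylSubcritical`; the two `CylSubcritical`
predicates are the same sentence over `Skelφ.cyl`). [cite: MartineauSevero2019, Cor. 2.2] -/
theorem coarseFrmFrom_cylSubcritical [Countable V] {t : V} (h1 : Φ.types = {t}) (hLN : Φ.L ≤ Φ.N) {p : unitInterval} (hC : Φ.CylSubcritical p) :
    (Φ.coarseFrmFrom h1 hLN).CylSubcritical p :=
  Φ.coarse_cylSubcritical h1 hC (Φ.coarseTypes h1)

/-! ## §3 Base-type proxies in carrier language -/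

/-- **PROXIES FOR THE COARSE SKELETON** (connected `G`, `L ≤ N`): one radius `D` such that every vertex `c` has a PROXY `c′` with a `coarseFrmFrom`-frame from the base type
`t` (`α t = c′`, the coarse chart translated EXACTLY), the same coarse position as `c`, and `c ∈ graphBall G c′ D` — part 4's `exists_proxies` read through `coarseFrmFrom_φ`.
[cite: KozmaNitzan2024, §4 pp. 19–21 ((21)–(25))] [this work] -/
theorem exists_proxies_frmFrom (hc : G.Connected) {t : V} (h1 : Φ.types = {t}) (hLN : Φ.L ≤ Φ.N) :
    ∃ D : ℕ, ∀ c : V, ∃ (c' : V) (α : G ≃g G), α t = c' ∧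
      (∀ w, (Φ.coarseFrmFrom h1 hLN).φ (α w) = (Φ.coarseFrmFrom h1 hLN).φ w + ((Φ.coarseFrmFrom h1 hLN).φ c' - (Φ.coarseFrmFrom h1 hLN).φ t)) ∧
      (Φ.coarseFrmFrom h1 hLN).φ c' = (Φ.coarseFrmFrom h1 hLN).φ c ∧ c ∈ graphBall G c' D := by
  obtain ⟨D, hD⟩ := Φ.exists_proxies hc h1
  refine ⟨D, fun c => ?_⟩
  obtain ⟨c', α, hαt, -, -, hcoarse, hcell, hcD, -⟩ := hD c
  exact ⟨c', α, hαt, hcoarse, hcell, hcD⟩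

end PlanarSkeletonFrmScaled

/-! ## §4 The seed of a proxy contains the vertex -/

namespace Skelφ

variable {V : Type} {G : SimpleGraph V} [G.LocallyFinite] [Countable V] {ψ : V → Site 2} {types : Finset V}

/-- **A vertex within graph distance `D ≤ k` of `c′` lies in the LEVEL-0 seed `fatSeq c′ k`** (`ψ` 1-Lipschitz: the walk stays in the cylinder of half-width `k`, and
`fatRadius k ≥ k ≥ D`).  With the seed floor `k ≥ D` this is 'the current cluster ∋ c ⇒ the current cluster meets Λ c′' of P3-NILPOTENT §19.12 (p4). [this work] -/
theorem mem_fatSeq_of_mem_graphBall (hlip : Lip G ψ) (hfr : Frames G ψ types) {p : unitInterval} (hC : CylSubcritical G ψ types p) {c c' : V} {D k : ℕ}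
    (h : c ∈ graphBall G c' D) (hk : D ≤ k) : c ∈ fatSeq hfr hC c' k :=
  (mem_fatSeq_iff hfr hC).2 (mem_cylBall_of_mem_graphBall hlip h hk (hk.trans (le_fatRadius hfr hC k)))

end Skelφ

end Summit.CriticalPhenomena.PercolationContinuityZ3.Theorems.Transplant

end
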